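import Summits.NavierStokesRegularity.NavierStokesRegularity.Theses.LevelSetModeration

/-!
# Route LevelSetModeration — `Assembly` (item stmt-NavierStokesRegularity-18538)

Pure logic: the route statements of `LevelSetModeration`, in the antecedent order

  `HighSpeedPressureWork → LevelSetClosure → BoundedToClay → NavierStokesRegularity`,

imply Clay (A). This is, hypothesis for hypothesis, the route's deciding theorem
`Summit.NavierStokesRegularity.NavierStokesRegularity.Theses.LevelSetModeration.closes`; the proof
below is self-contained (it does not invoke `closes`), so that it depends only on the item
definitions.

Argument. `BoundedToClay` reduces `NavierStokesRegularity` to: every classical solution of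
unforced Navier–Stokes on `ℝ³ × [0, T)` that is Leray–Hopf on `[0, T]` from a rapidly decaying
datum is bounded on `[0, T) × ℝ³`. Fix such `ν, T, u, p`. Rapid decay of `u 0` at order `n = 0`,
weight `K = 0` gives `B₀ = C₀₀` with `‖u 0 x‖ ≤ B₀`; put `E₀ := ∫ ‖u 0 x‖²`.
`HighSpeedPressureWork ν T` supplies `m < 10/3`, the modulus `F` and the pressure-work bound for
all `M ≥ 2B₀`, `c ∈ [M/2, M]`, `t < T`; `LevelSetClosure` with `Λ := F E₀ B₀`,
`M₀ := 2B₀ + 2 > 0` (note `B₀ ≥ ‖u 0 0‖ ≥ 0` and `‖u 0 x‖ ≤ M₀/2`) yields the bound `B`.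
Nothing here is new mathematics; the open content lives in the cruxes
`HighSpeedPressureWork` / `LevelSetClosure`.

## References
* A. Vasseur, *A new proof of partial regularity of solutions to Navier–Stokes equations*,
  NoDEA 14 (2007), Conj. 14 and Appendix. [Vasseur2007]
* C. L. Fefferman, *Existence and smoothness of the Navier–Stokes equation*, Clay (2000), (A).
  [Fefferman2000]
-/

-- single-conjunct summit: `Summit.<Summit>.<Problem>` repeats the name by the D-0017 layout
set_option linter.dupNamespace false

namespace Summit.NavierStokesRegularity.NavierStokesRegularity.Theorems

open Summit.NavierStokesRegularity.NavierStokesRegularity.Theses.LevelSetModeration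

/-- **`Assembly`** (item stmt-NavierStokesRegularity-18538 of route LevelSetModeration):
`HighSpeedPressureWork → LevelSetClosure → BoundedToClay → NavierStokesRegularity`.
Pure logic (the argument of the route's deciding theorem `closes`, re-proved from the item
definitions alone): the two cruxes bound every classical Leray–Hopf solution from a rapidly
decaying datum on `[0, T)` (initial speed bound `B₀ = C₀₀` from rapid decay at order `0`,
weight `0`; `E₀ = ∫ ‖u 0‖²`; `Λ = F E₀ B₀`, `M₀ = 2B₀ + 2`), and `BoundedToClay` turns that into
Clay (A). -/
theorem levelSetModeration_assembly_proof :
    Summit.NavierStokesRegularity.NavierStokesRegularity.Theses.LevelSetModeration.Assembly := by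
  unfold Assembly
  intro h₁ h₂ h₃
  refine h₃ ?_
  intro ν T hν hT u p hcl hLH hdec
  obtain ⟨m, hm, F, hF⟩ := h₁ ν T hν hT
  obtain ⟨C₀, hC₀⟩ := hdec 0 0
  have hB : ∀ x, ‖u 0 x‖ ≤ C₀ := fun x => by
    have h := hC₀ x
    rwa [pow_zero, one_mul, norm_iteratedFDeriv_zero] at h
  have hB' : ∀ x, ‖u 0 x‖ ≤ (2 * C₀ + 2) / 2 := fun x => by
    have := hB x
    linarith
  have hM₀ : 0 < 2 * C₀ + 2 := by
    have := le_trans (norm_nonneg _) (hB 0)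
    linarith
  have hW := hF u p hcl hLH hdec (∫ x, ‖u 0 x‖ ^ 2) C₀ le_rfl hB
  exact h₂ ν T hν hT u p hcl hLH hdec m (F (∫ x, ‖u 0 x‖ ^ 2) C₀) (2 * C₀ + 2) hm hM₀ hB'
    (fun M c t hM hc hcM hc0 ht => hW M c t (by linarith) hc hcM hc0 ht)

end Summit.NavierStokesRegularity.NavierStokesRegularity.Theorems
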